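import Summits.QuantumFields.YangMills.Theorems.BalabanUVNodesK1R9WindowConjunctIdle
import Summits.QuantumFields.YangMills.Theorems.BalabanUVNodesK1R9VersionSlotIffAEDisplayAtRecord
import Summits.QuantumFields.YangMills.Theorems.BalabanUVNodesK1R9SlotOfAESuccLevelZeroAtRecord

/-!
# BalabanUVNodes ∕ K1⁹ — THE DECIDING CRUX IN BAŁABAN's A.E. CURRENCY, BY NAME: `…Theses.BalabanUVNodes.StabilityBRunRowsAtRecordR13SepCoPHV` ⟺ «(unity ∧ slots) ∧ Admissible ∧
# ([II] Theorem 1's clause ∧ [III] Cor. 3 (2.50) at level 0 for EVERY field ∧ (2.50) `dV_{k+1}`-A.E. at levels `k+1 ≤ K`, all AT THE RECORD) ∧ the rows» — NO version slot, NO window conjunct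

Cell `pub-ymgap` (HUMAN RULING D-0062 Track A ∕ D-0149 width), WIDTH SEAT `pub-ymgap-dag-n13-w1` (gen 5, CLAIM-6), key K1⁹ `StabilityBRunRowsAtRecordR13SepCoPHV` = stmt-QuantumFields-27364
(`route-QuantumFields-BalabanUVNodes` rev 28∕29, commit 5c92291ad69b; director-ym №210 (δ) NULL-SET SURGERY, plan g85 `D85-REV28` recipe (δⱽ); `--kind proof --supports … --as helper`;
count-neutral).  Kernel bookkeeping over LANDED files only:

* `…Theorems.BalabanUVNodesK1R9WindowConjunctIdle.stabilityBRunRowsAtRecordR13SepCoPHV_iff_windowFree` (the crux ⟺ its window-free text: the `∃ γ₁` window is row (i) of `RunRowsCont13`);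
* this seat's `…K1R9VersionSlotIffAEDisplayAtRecord.exists_revision₁₃_endStatementBPrinted_iff_aeDisplay` (p625282: at every `(θ, h)`, «`∃ v : Node00.Revision₁₃ F 2 θ h`, (B) AS PRINTED at
  `Node00.datumOfRecord₁₃SepCoPHV F 2 θ h v`» ⟺ «`B16.Thm1Printed` at the record ∧ `∃ γ > 0, ∃ em ep`, (2.50) at level 0 for every field on γ-windowed runs ∧ (2.50) `dV_{k+1}`-a.e. at levels
  `k+1 ≤ K`», built on `TowerReviseAE.exists_tower_endStatementBPrinted_of_ae` p620313 and DEF-1's `Node00/Record13SepCoPHV.lean` p620607);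
* this seat's `…K1R9SlotOfAESuccLevelZeroAtRecord.exists_revision₁₃_endStatementBPrinted_of_aeSucc_of_betaLowerH` (p623627: the level-0 face discharged sign-free at the witness letters
  `θ.Efl ≡ 0`, `θ.logz ≡ 0`, `0 < γ ≤ 1`, `0 ≤ β′`, `BetaLowerH (−β′) γ β_θ`, via dag-n13-w1 g0's p590719).

CONTENTS.  §1 ★★★ `stabilityBRunRowsAtRecordR13SepCoPHV_iff_aeCurrency` — THE CRUX ⟺ ITS A.E.-CURRENCY TEXT: the right-hand side binds NO revision `v`, carries NO window conjunct, and reads the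
record's densities above level 0 ONLY under `∀ᵐ V ∂fieldMeasure (F.P p.K) (k+1) (SU 2)` — so it is insensitive to which version of the Radon–Nikodym density `Classical.choose` selected (the
located pin of the aside K1⁸, this seat's p618356 ∕ dag-n13-w2's p617654, has no purchase on it), and it is what [III] p.264 means by (2.50) «for the densities ρ_k» (defined up to `dV_k`-null
sets).  §2 ★★ `stabilityBRunRowsAtRecordR13SepCoPHV_of_aeCurrency` ∕ `aeCurrency_of_stabilityBRunRowsAtRecordR13SepCoPHV` (the two directions as citable arrows) and ★★
`stabilityBRunRowsAtRecordR13SepCoPHV_of_aeSuccRoad` — THE SUPPLIER-FACING CLOSING TEMPLATE WITH LEVEL 0 DISCHARGED: K1⁹ ⟸ «`∀ F, Inhabited13 F → ∃ θ h`, (unity ∧ slots) ∧ Admissible ∧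
Thm1Printed (record) ∧ `θ.Efl ≡ 0` ∧ `θ.logz ≡ 0` ∧ `∃ γ β′, 0 < γ ≤ 1 ∧ 0 ≤ β′ ∧ BetaLowerH (−β′) γ β_θ ∧ ∃ em ep`, (2.50) `dV_{k+1}`-a.e. at levels `k+1 ≤ K` on γ-windowed runs ∧
`RunRowsCont13 F θ`» — exactly ONE analytic entry of the (B)-face left open ([III] Cor. 3 at levels ≥ 1, a.e. currency; N13's (o1)∕measure-currency roads, dag-n13-w2 ∕ w3), the rest are
NODE O's rows and Theorem 1's clause.  §3 `aeCurrency_of_stabilityBRunRowsAtRecordR13SepCoPH` — history link: the ASIDE K1⁸ (stmt-QuantumFields-26907) ⟹ the a.e.-currency text (door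
`Revision₁₃.refl`, DEF-1's `…VersionSlotDefs.stabilityBRunRowsAtRecordR13SepCoPHV_of_k1R8`).

HONEST FRAMING.  Count-neutral kernel bookkeeping; nothing of Bałaban's asserted or refuted; NEITHER side of the equivalence is proved here; K1⁹ (deciding crux, 0∕3) NEITHER proved NOR
refuted; N13 NOT discharged; no stub closed; counts unmoved (typed 28∕28 · discharged 5∕27 · A 5∕28); one finite `𝕋⁴_{L^K}` programme at fixed ε; R4 closes the CONDITIONAL finite-𝕋⁴
rung `BalabanLadder.UV` only — the Yang–Mills mass gap (Clay) is NOT proved by any of this.  No `sorry`, `def`, `instance`, `notation`; standard axioms.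
-/

noncomputable section

open scoped BigOperators ENNReal NNReal Matrix.Norms.L2Operator

namespace Summit.QuantumFields.YangMills.BalabanUVNodes.K1R9CruxIffAECurrency

open MeasureTheory
open Literature.MathematicalPhysics.QuantumFieldTheory.Balaban1983to89
open Literature.MathematicalPhysics.QuantumFieldTheory.Balaban1983to89.T4Continuum (T4Family FiniteEpsData)
open Literature.MathematicalPhysics.QuantumFieldTheory.Balaban1983to89.Node00
open Literature.MathematicalPhysics.QuantumFieldTheory.Balaban1983to89.FlowStep (BetaLowerH)
open Summit.QuantumFields.YangMills.Theorems.K1V6Defs (Inhabited13 Window)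
open Summit.QuantumFields.YangMills.Theorems.BalabanUVNodesK1R8RowsDefs (RunRowsCont13)
open Summit.QuantumFields.YangMills.Theorems.BalabanUVNodesK1R9WindowConjunctIdle
  (stabilityBRunRowsAtRecordR13SepCoPHV_iff_windowFree stabilityBRunRowsAtRecordR13SepCoPH_iff_windowFree)
open Summit.QuantumFields.YangMills.BalabanUVNodes.K1R9VersionSlotIffAEDisplayAtRecord (exists_revision₁₃_endStatementBPrinted_iff_aeDisplay)
open Summit.QuantumFields.YangMills.BalabanUVNodes.K1R9SlotOfAESuccLevelZeroAtRecord (exists_revision₁₃_endStatementBPrinted_of_aeSucc_of_betaLowerH)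
open Summit.QuantumFields.YangMills.Theses.BalabanUVNodes (StabilityBRunRowsAtRecordR13SepCoPHV StabilityBRunRowsAtRecordR13SepCoPH)

/-! ## §1 The deciding crux ⟺ its a.e.-currency text -/

/-- ★★★ **K1⁹ ⟺ ITS A.E.-CURRENCY TEXT, BY NAME** (kernel).  The route decl `…Theses.BalabanUVNodes.StabilityBRunRowsAtRecordR13SepCoPHV` (stmt-QuantumFields-27364, deciding crux of rev 28∕29)
holds iff for every family with an admissible unity Stage-13 tuple there is a witness `(θ, h)` with (unity ∧ slots), admissibility, [II] Theorem 1's clause at the record datum, exponents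
`γ > 0`, `E₋ = em`, `E₊ = ep` such that [III] Cor. 3 (2.50) holds at level 0 for EVERY field and `dV_{k+1}`-a.e. at every level `k+1 ≤ K` of every γ-windowed run — all read AT THE RECORD
`Node00.datumOfRecord₁₃SepCoPH F 2 θ h` — and the rows `RunRowsCont13 F θ`.  NO version slot and NO window conjunct on the right: the slot is eliminated by p625282's
`exists_revision₁₃_endStatementBPrinted_iff_aeDisplay`, the window by `…K1R9WindowConjunctIdle.…_iff_windowFree`.
[cite: Balaban1989LargeFieldII, Thm 1 + (0.1) pp.355–356; Balaban1988Convergent, (2.18) p.257, Cor. 3 (2.50) p.264; Balaban1987RG1, Thm 3 p.264, (5.10) p.293, §1 pp.263–264 (bookkeeping)] -/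
theorem stabilityBRunRowsAtRecordR13SepCoPHV_iff_aeCurrency :
    StabilityBRunRowsAtRecordR13SepCoPHV ↔
      ∀ F : T4Family, Inhabited13 F → ∃ (θ : Stage13HParams F 2) (h : θ.Provisos₁₃SepCoPH F 2),
        (θ.ZhUnity F 2 ∧ θ.SlotsNondegenerate₁₃ F 2) ∧ θ.Admissible F 2 ∧
        (B16.Thm1Printed (datumOfRecord₁₃SepCoPH F 2 θ h).C ∧
          ∃ γ : ℝ, 0 < γ ∧ ∃ em ep : ℝ → ℝ,
            (∀ p : B12.RunParams, ((datumOfRecord₁₃SepCoPH F 2 θ h).C p).flow.InInterval γ p.K →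
              ∀ V : GaugeField (F.P p.K) 0 (SU 2),
                B16.UVIneq ((datumOfRecord₁₃SepCoPH F 2 θ h).C p) 0 V (em (((datumOfRecord₁₃SepCoPH F 2 θ h).C p).flow.g 0))
                  (ep (((datumOfRecord₁₃SepCoPH F 2 θ h).C p).flow.g 0))) ∧
            (∀ p : B12.RunParams, ((datumOfRecord₁₃SepCoPH F 2 θ h).C p).flow.InInterval γ p.K → ∀ k : ℕ, k + 1 ≤ p.K →
              ∀ᵐ V ∂fieldMeasure (F.P p.K) (k + 1) (SU 2),
                B16.UVIneq ((datumOfRecord₁₃SepCoPH F 2 θ h).C p) (k + 1) V (em (((datumOfRecord₁₃SepCoPH F 2 θ h).C p).flow.g (k + 1)))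
                  (ep (((datumOfRecord₁₃SepCoPH F 2 θ h).C p).flow.g (k + 1))))) ∧
        RunRowsCont13 F θ := by
  rw [stabilityBRunRowsAtRecordR13SepCoPHV_iff_windowFree]
  refine forall_congr' fun F => imp_congr_right fun _ => exists_congr fun θ => exists_congr fun h => ?_
  constructor
  · rintro ⟨v, hU, hθ, hB, hrows⟩
    exact ⟨hU, hθ, (exists_revision₁₃_endStatementBPrinted_iff_aeDisplay θ h).1 ⟨v, hB⟩, hrows⟩
  · rintro ⟨hU, hθ, hae, hrows⟩
    obtain ⟨v, hB⟩ := (exists_revision₁₃_endStatementBPrinted_iff_aeDisplay θ h).2 hae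
    exact ⟨v, hU, hθ, hB, hrows⟩

/-! ## §2 The two directions as arrows, and the supplier-facing template with level 0 discharged -/

/-- ★★ **K1⁹ FROM ITS A.E.-CURRENCY TEXT** (the closing direction of §1 as a citable arrow): a supplier of «(unity ∧ slots) ∧ Admissible ∧ Thm 1 (record) ∧ (2.50) at level 0 everywhere ∧ (2.50)
a.e. above level 0 ∧ rows» at ONE witness per family closes the deciding crux BY NAME.  CONDITIONAL on the displayed hypothesis; K1⁹ NOT closed here.
[cite: Balaban1989LargeFieldII, Thm 1 + (0.1) pp.355–356; Balaban1988Convergent, Cor. 3 (2.50) p.264; Balaban1987RG1, Thm 3 p.264, (5.10) p.293, §1 pp.263–264 (bookkeeping)] -/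
theorem stabilityBRunRowsAtRecordR13SepCoPHV_of_aeCurrency
    (hae : ∀ F : T4Family, Inhabited13 F → ∃ (θ : Stage13HParams F 2) (h : θ.Provisos₁₃SepCoPH F 2),
      (θ.ZhUnity F 2 ∧ θ.SlotsNondegenerate₁₃ F 2) ∧ θ.Admissible F 2 ∧
      (B16.Thm1Printed (datumOfRecord₁₃SepCoPH F 2 θ h).C ∧
        ∃ γ : ℝ, 0 < γ ∧ ∃ em ep : ℝ → ℝ,
          (∀ p : B12.RunParams, ((datumOfRecord₁₃SepCoPH F 2 θ h).C p).flow.InInterval γ p.K →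
            ∀ V : GaugeField (F.P p.K) 0 (SU 2),
              B16.UVIneq ((datumOfRecord₁₃SepCoPH F 2 θ h).C p) 0 V (em (((datumOfRecord₁₃SepCoPH F 2 θ h).C p).flow.g 0))
                (ep (((datumOfRecord₁₃SepCoPH F 2 θ h).C p).flow.g 0))) ∧
          (∀ p : B12.RunParams, ((datumOfRecord₁₃SepCoPH F 2 θ h).C p).flow.InInterval γ p.K → ∀ k : ℕ, k + 1 ≤ p.K →
            ∀ᵐ V ∂fieldMeasure (F.P p.K) (k + 1) (SU 2),
              B16.UVIneq ((datumOfRecord₁₃SepCoPH F 2 θ h).C p) (k + 1) V (em (((datumOfRecord₁₃SepCoPH F 2 θ h).C p).flow.g (k + 1)))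
                (ep (((datumOfRecord₁₃SepCoPH F 2 θ h).C p).flow.g (k + 1))))) ∧
      RunRowsCont13 F θ) :
    StabilityBRunRowsAtRecordR13SepCoPHV :=
  stabilityBRunRowsAtRecordR13SepCoPHV_iff_aeCurrency.2 hae

/-- ★★ **… AND CONVERSELY**: the deciding crux ⟹ its a.e.-currency text (every revision's (2.50), pointwise at the revised datum, is the record's (2.50) at level 0 field by field and
`dV_{k+1}`-a.e. above, p625282 §1). [cite: Balaban1989LargeFieldII, Thm 1 + (0.1) pp.355–356; Balaban1988Convergent, Cor. 3 (2.50) p.264 (bookkeeping)] -/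
theorem aeCurrency_of_stabilityBRunRowsAtRecordR13SepCoPHV (hK1 : StabilityBRunRowsAtRecordR13SepCoPHV) :
    ∀ F : T4Family, Inhabited13 F → ∃ (θ : Stage13HParams F 2) (h : θ.Provisos₁₃SepCoPH F 2),
      (θ.ZhUnity F 2 ∧ θ.SlotsNondegenerate₁₃ F 2) ∧ θ.Admissible F 2 ∧
      (B16.Thm1Printed (datumOfRecord₁₃SepCoPH F 2 θ h).C ∧
        ∃ γ : ℝ, 0 < γ ∧ ∃ em ep : ℝ → ℝ,
          (∀ p : B12.RunParams, ((datumOfRecord₁₃SepCoPH F 2 θ h).C p).flow.InInterval γ p.K →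
            ∀ V : GaugeField (F.P p.K) 0 (SU 2),
              B16.UVIneq ((datumOfRecord₁₃SepCoPH F 2 θ h).C p) 0 V (em (((datumOfRecord₁₃SepCoPH F 2 θ h).C p).flow.g 0))
                (ep (((datumOfRecord₁₃SepCoPH F 2 θ h).C p).flow.g 0))) ∧
          (∀ p : B12.RunParams, ((datumOfRecord₁₃SepCoPH F 2 θ h).C p).flow.InInterval γ p.K → ∀ k : ℕ, k + 1 ≤ p.K →
            ∀ᵐ V ∂fieldMeasure (F.P p.K) (k + 1) (SU 2),
              B16.UVIneq ((datumOfRecord₁₃SepCoPH F 2 θ h).C p) (k + 1) V (em (((datumOfRecord₁₃SepCoPH F 2 θ h).C p).flow.g (k + 1)))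
                (ep (((datumOfRecord₁₃SepCoPH F 2 θ h).C p).flow.g (k + 1))))) ∧
      RunRowsCont13 F θ :=
  stabilityBRunRowsAtRecordR13SepCoPHV_iff_aeCurrency.1 hK1

/-- ★★ **THE SUPPLIER-FACING CLOSING TEMPLATE WITH LEVEL 0 DISCHARGED** (kernel composition).  K1⁹ BY NAME follows from: at ONE witness `(θ, h)` per family with an admissible unity tuple —
(unity ∧ slots), admissibility, [II] Theorem 1's clause at the record, the normalisation letters `θ.Efl ≡ 0` and `θ.logz ≡ 0`, a window width `0 < γ ≤ 1` and a β-floor `BetaLowerH (−β′) γ β_θ`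
with `0 ≤ β′` (NODE O letters), exponents `em ep` with [III] Cor. 3 (2.50) `dV_{k+1}`-A.E. AT LEVELS `k+1 ≤ K` of every γ-windowed run (THE ONE OPEN ANALYTIC ENTRY of the (B)-face — N13 in
a.e. currency), and the rows `RunRowsCont13 F θ`.  Level 0 of (2.50) is supplied field by field and sign-free by p623627 (dag-n13-w1 g0's p590719 underneath), the version slot by the (δ)
surgery p620313 + DEF-1's adapter, the window by row (i).  CONDITIONAL on the displayed hypotheses; K1⁹ NOT closed here; nothing of Bałaban asserted.
[cite: Balaban1989LargeFieldII, Thm 1 + (0.1) pp.355–356; Balaban1988Convergent, (2.18) p.257, Cor. 3 (2.50) p.264; Balaban1987RG1, Thm 3 p.264, (5.10) p.293, §1 pp.263–264 (bookkeeping)] -/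
theorem stabilityBRunRowsAtRecordR13SepCoPHV_of_aeSuccRoad
    (hroad : ∀ F : T4Family, Inhabited13 F → ∃ (θ : Stage13HParams F 2) (h : θ.Provisos₁₃SepCoPH F 2),
      (θ.ZhUnity F 2 ∧ θ.SlotsNondegenerate₁₃ F 2) ∧ θ.Admissible F 2 ∧
      B16.Thm1Printed (datumOfRecord₁₃SepCoPH F 2 θ h).C ∧
      (∀ (P : B12.RunParams) (j : ℕ), θ.Efl P j = 0) ∧ (∀ (P : B12.RunParams) (j : ℕ), θ.logz P j = 0) ∧
      (∃ γ β' : ℝ, 0 < γ ∧ γ ≤ 1 ∧ 0 ≤ β' ∧ BetaLowerH (-β') γ (betaOfRecord₁₃ F 2 θ.toStage13Params) ∧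
        ∃ em ep : ℝ → ℝ,
          ∀ p : B12.RunParams, ((datumOfRecord₁₃SepCoPH F 2 θ h).C p).flow.InInterval γ p.K → ∀ k : ℕ, k + 1 ≤ p.K →
            ∀ᵐ V ∂fieldMeasure (F.P p.K) (k + 1) (SU 2),
              B16.UVIneq ((datumOfRecord₁₃SepCoPH F 2 θ h).C p) (k + 1) V (em (((datumOfRecord₁₃SepCoPH F 2 θ h).C p).flow.g (k + 1)))
                (ep (((datumOfRecord₁₃SepCoPH F 2 θ h).C p).flow.g (k + 1)))) ∧
      RunRowsCont13 F θ) :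
    StabilityBRunRowsAtRecordR13SepCoPHV := by
  rw [stabilityBRunRowsAtRecordR13SepCoPHV_iff_windowFree]
  intro F hinh
  obtain ⟨θ, h, hU, hθ, h1, hEfl, hlogz, ⟨γ, β', hγ, hγ1, hβ', hβ, em, ep, hae⟩, hrows⟩ := hroad F hinh
  obtain ⟨v, hB⟩ := exists_revision₁₃_endStatementBPrinted_of_aeSucc_of_betaLowerH θ h hEfl hlogz hγ hγ1 hβ' hβ h1 em ep hae
  exact ⟨θ, h, v, hU, hθ, hB, hrows⟩

/-! ## §3 History link: the aside K1⁸ ⟹ the a.e.-currency text -/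

/-- **THE ASIDE K1⁸ ⟹ THE A.E.-CURRENCY TEXT** (history; stmt-QuantumFields-26907, rev 26ᴿ∕27): (B) AS PRINTED at the UNREVISED record datum is (B) at the slot datum of `Revision₁₃.refl`
(DEF-1's door, `rfl`), hence the a.e. display by §1 — the rev-27 letter was the STRONGER (version-pinned) text.  CONDITIONAL; nothing closed.
[cite: Balaban1989LargeFieldII, Thm 1 + (0.1) pp.355–356; Balaban1988Convergent, Cor. 3 (2.50) p.264 (bookkeeping)] -/
theorem aeCurrency_of_stabilityBRunRowsAtRecordR13SepCoPH (hK1 : StabilityBRunRowsAtRecordR13SepCoPH) :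
    ∀ F : T4Family, Inhabited13 F → ∃ (θ : Stage13HParams F 2) (h : θ.Provisos₁₃SepCoPH F 2),
      (θ.ZhUnity F 2 ∧ θ.SlotsNondegenerate₁₃ F 2) ∧ θ.Admissible F 2 ∧
      (B16.Thm1Printed (datumOfRecord₁₃SepCoPH F 2 θ h).C ∧
        ∃ γ : ℝ, 0 < γ ∧ ∃ em ep : ℝ → ℝ,
          (∀ p : B12.RunParams, ((datumOfRecord₁₃SepCoPH F 2 θ h).C p).flow.InInterval γ p.K →
            ∀ V : GaugeField (F.P p.K) 0 (SU 2),
              B16.UVIneq ((datumOfRecord₁₃SepCoPH F 2 θ h).C p) 0 V (em (((datumOfRecord₁₃SepCoPH F 2 θ h).C p).flow.g 0))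
                (ep (((datumOfRecord₁₃SepCoPH F 2 θ h).C p).flow.g 0))) ∧
          (∀ p : B12.RunParams, ((datumOfRecord₁₃SepCoPH F 2 θ h).C p).flow.InInterval γ p.K → ∀ k : ℕ, k + 1 ≤ p.K →
            ∀ᵐ V ∂fieldMeasure (F.P p.K) (k + 1) (SU 2),
              B16.UVIneq ((datumOfRecord₁₃SepCoPH F 2 θ h).C p) (k + 1) V (em (((datumOfRecord₁₃SepCoPH F 2 θ h).C p).flow.g (k + 1)))
                (ep (((datumOfRecord₁₃SepCoPH F 2 θ h).C p).flow.g (k + 1))))) ∧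
      RunRowsCont13 F θ := by
  intro F hinh
  obtain ⟨θ, h, hU, hθ, hB, hrows⟩ := stabilityBRunRowsAtRecordR13SepCoPH_iff_windowFree.1 hK1 F hinh
  exact ⟨θ, h, hU, hθ, (exists_revision₁₃_endStatementBPrinted_iff_aeDisplay θ h).1 ⟨Revision₁₃.refl F 2 θ h, hB⟩, hrows⟩

end Summit.QuantumFields.YangMills.BalabanUVNodes.K1R9CruxIffAECurrency
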